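import Mathlib.FieldTheory.AbelRuffini
import Mathlib.FieldTheory.Galois.Basic
import Mathlib.FieldTheory.SeparableClosure
import HarnessLib

/-!
# The compositum of finite Galois extensions with soluble Galois groups is Galois and soluble

Topic `Literature/FieldTheory/Galois`; a *proofs* file (theorems only, no definitions, no named
facts).  For intermediate fields `E₁, E₂` of an extension `L/F`, each finite Galois over `F` with
soluble Galois group, the compositum `E₁E₂ = E₁ ⊔ E₂` is finite Galois over `F` with soluble
Galois group (`Gal(E₁E₂/F) ↪ Gal(E₁/F) × Gal(E₂/F)`): Lang, *Algebra*, Ch. VI §1, Thm. 1.14 and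
Cor. 1.15 ("if `K₁, K₂` are Galois over `k` then `K₁K₂` is Galois over `k` … the map
`σ ↦ (σ|K₁, σ|K₂)` is injective"), and Ch. VI §7, Prop. 7.1 (the class of solvable extensions is
closed under composita).  Here it is obtained from Mathlib's polynomial form: `Eᵢ` is the splitting
field of a separable `pᵢ` (`IsGalois.is_separable_splitting_field`), `E₁ ⊔ E₂` that of `p₁p₂`
(`IntermediateField.isSplittingField_iSup`), and `Gal(p₁p₂) ↪ Gal(p₁) × Gal(p₂)` is soluble
(`gal_mul_isSolvable`).  Degree-`≤ 2` subextensions are Galois (in characteristic `≠ 2`, Mathlib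
`IsQuadraticExtension.isGalois`) with abelian, hence soluble, group, so iterating gives the
solubility of composita such as `E = E₀ · E_a · E_b · E_c` (a soluble Galois `E₀/F` with three
quadratic fields) in Allen–Calegari–Caraiani–Gee–Helm–Le Hung–Newton–Scholze–Taylor–Thorne, proof of
Thm. 6.1.1 ("Then `E/F` is a soluble CM extension", arXiv:1812.09999 p. 89) — the hypotheses
`IsGalois F E`, `IsSolvable (E ≃ₐ[F] E)` of the tree's soluble base change / descent facts
`Literature.NumberTheory.Automorphic.ACC2023.solubleDescent_isAutomorphic`.

## References

* S. Lang, *Algebra*, 3rd ed., GTM 211, Springer 2002, Ch. VI §1 Thm. 1.14, Cor. 1.15; §7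
  Prop. 7.1. [Lang2002]
* [ACCGHLNSTT2023] P. B. Allen et al., *Potential automorphy over CM fields*, Ann. of Math. 197
  (2023), §6.5, proof of Thm. 6.1.1 (p. 89 of arXiv:1812.09999).
-/

noncomputable section

open Polynomial IntermediateField

namespace Literature.FieldTheory.Galois

variable {F L : Type*} [Field F] [Field L] [Algebra F L]

/-! ## Composita of Galois extensions -/

/-- **The compositum of two finite Galois subextensions is Galois** (Mathlib's `normal_sup` and
`isSeparable_sup`).  Lang, *Algebra*, VI Thm. 1.14. [cite: Lang2002, Ch. VI §1 Thm. 1.14] -/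
theorem isGalois_sup (E₁ E₂ : IntermediateField F L) [IsGalois F E₁] [IsGalois F E₂] :
    IsGalois F (E₁ ⊔ E₂ : IntermediateField F L) := {}

/-- **The compositum of splitting fields of `p₁`, `p₂` is a splitting field of `p₁ p₂`** (the
two-field case of Mathlib's `IntermediateField.isSplittingField_iSup`). [folklore] -/
theorem isSplittingField_sup {E₁ E₂ : IntermediateField F L} {p₁ p₂ : F[X]} (hp : p₁ * p₂ ≠ 0)
    (h₁ : p₁.IsSplittingField F E₁) (h₂ : p₂.IsSplittingField F E₂) :
    (p₁ * p₂).IsSplittingField F (E₁ ⊔ E₂ : IntermediateField F L) := by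
  classical
  have key := IntermediateField.isSplittingField_iSup (K := F) (L := L)
    (t := fun b : Bool => cond b E₁ E₂) (p := fun b : Bool => cond b p₁ p₂) (s := Finset.univ)
    (by rw [Fintype.prod_bool]; exact hp) (by rintro (_ | _) - <;> assumption)
  rw [Fintype.prod_bool] at key
  have heq : (⨆ b ∈ (Finset.univ : Finset Bool), cond b E₁ E₂ : IntermediateField F L) = E₁ ⊔ E₂ := by
    have h1 : (⨆ b ∈ (Finset.univ : Finset Bool), cond b E₁ E₂ : IntermediateField F L) =
        ⨆ b : Bool, cond b E₁ E₂ :=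
      iSup_congr fun b => iSup_pos (Finset.mem_univ b)
    rw [h1, iSup_bool_eq]
    rfl
  haveI := key
  exact IsSplittingField.of_algEquiv (↥(E₁ ⊔ E₂)) (cond true p₁ p₂ * cond false p₁ p₂)
    (IntermediateField.equivOfEq heq)

/-- The Galois group of a splitting field of `p` is soluble iff `Gal(p)` is (transport along
`IsSplittingField.algEquiv`). [folklore] -/
theorem isSolvable_gal_of_isSplittingField {E : Type*} [Field E] [Algebra F E] (p : F[X])
    [p.IsSplittingField F E] [h : IsSolvable (E ≃ₐ[F] E)] : IsSolvable p.Gal :=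
  solvable_of_surjective (f := (IsSplittingField.algEquiv E p).autCongr.toMonoidHom)
    (IsSplittingField.algEquiv E p).autCongr.surjective

/-- Conversely, the automorphism group of a splitting field of `p` is soluble if `Gal(p)` is.
[folklore] -/
theorem isSolvable_algEquiv_of_isSplittingField {E : Type*} [Field E] [Algebra F E] (p : F[X])
    [p.IsSplittingField F E] (h : IsSolvable p.Gal) : IsSolvable (E ≃ₐ[F] E) :=
  haveI : IsSolvable (p.SplittingField ≃ₐ[F] p.SplittingField) := h
  solvable_of_surjective (f := (IsSplittingField.algEquiv E p).autCongr.symm.toMonoidHom)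
    (IsSplittingField.algEquiv E p).autCongr.symm.surjective

/-- **The compositum of two finite Galois extensions with soluble Galois groups has soluble Galois
group.**  For intermediate fields `E₁, E₂` of `L/F`, finite Galois over `F` with `Gal(Eᵢ/F)`
soluble, `Gal(E₁E₂/F)` is soluble: writing `Eᵢ` as the splitting field of a separable `pᵢ`,
`E₁E₂` is the splitting field of `p₁p₂` and `Gal(p₁p₂) ↪ Gal(p₁) × Gal(p₂)`
(`gal_mul_isSolvable`).  Lang, *Algebra*, VI Cor. 1.15 and §7 Prop. 7.1.
[cite: Lang2002, Ch. VI §1 Cor. 1.15 and §7 Prop. 7.1] -/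
theorem isSolvable_algEquiv_sup (E₁ E₂ : IntermediateField F L) [FiniteDimensional F E₁]
    [FiniteDimensional F E₂] [IsGalois F E₁] [IsGalois F E₂]
    [h₁ : IsSolvable (E₁ ≃ₐ[F] E₁)] [h₂ : IsSolvable (E₂ ≃ₐ[F] E₂)] :
    IsSolvable ((E₁ ⊔ E₂ : IntermediateField F L) ≃ₐ[F] (E₁ ⊔ E₂ : IntermediateField F L)) := by
  obtain ⟨p₁, hs₁, hp₁⟩ := IsGalois.is_separable_splitting_field F E₁
  obtain ⟨p₂, hs₂, hp₂⟩ := IsGalois.is_separable_splitting_field F E₂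
  haveI hsup := isSplittingField_sup (mul_ne_zero hs₁.ne_zero hs₂.ne_zero) hp₁ hp₂
  haveI := hp₁
  haveI := hp₂
  have g₁ : IsSolvable p₁.Gal := isSolvable_gal_of_isSplittingField (E := E₁) p₁
  have g₂ : IsSolvable p₂.Gal := isSolvable_gal_of_isSplittingField (E := E₂) p₂
  exact isSolvable_algEquiv_of_isSplittingField (p₁ * p₂) (gal_mul_isSolvable g₁ g₂)

/-- **Composita of finite Galois extensions with soluble groups, packaged**: `E₁ ⊔ E₂` is finite
Galois over `F` with soluble Galois group. [cite: Lang2002, Ch. VI §1 Cor. 1.15 and §7 Prop. 7.1] -/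
theorem isGalois_and_isSolvable_sup (E₁ E₂ : IntermediateField F L) [FiniteDimensional F E₁]
    [FiniteDimensional F E₂] [IsGalois F E₁] [IsGalois F E₂]
    [IsSolvable (E₁ ≃ₐ[F] E₁)] [IsSolvable (E₂ ≃ₐ[F] E₂)] :
    FiniteDimensional F (E₁ ⊔ E₂ : IntermediateField F L) ∧
      IsGalois F (E₁ ⊔ E₂ : IntermediateField F L) ∧
      IsSolvable ((E₁ ⊔ E₂ : IntermediateField F L) ≃ₐ[F] (E₁ ⊔ E₂ : IntermediateField F L)) :=
  ⟨inferInstance, isGalois_sup E₁ E₂, isSolvable_algEquiv_sup E₁ E₂⟩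

/-! ## Subextensions of degree at most `2` -/

/-- **A group of order at most `2` is commutative** (it is trivial or cyclic of prime order).
[folklore] -/
theorem mul_comm_of_card_le_two {G : Type*} [Group G] [Finite G] (h : Nat.card G ≤ 2)
    (a b : G) : a * b = b * a := by
  rcases Nat.lt_or_ge (Nat.card G) 2 with hlt | hge
  · have h1 : Nat.card G ≤ 1 := by omega
    haveI := Finite.card_le_one_iff_subsingleton.1 h1
    exact Subsingleton.elim _ _
  · have h2 : Nat.card G = 2 := le_antisymm h hge
    haveI : Fact (Nat.Prime 2) := ⟨Nat.prime_two⟩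
    haveI : IsCyclic G := isCyclic_of_prime_card h2
    obtain ⟨g, hg⟩ := IsCyclic.exists_generator (α := G)
    obtain ⟨m, rfl⟩ := hg a
    obtain ⟨n, rfl⟩ := hg b
    exact zpow_mul_comm g m n

/-- **An extension of degree `≤ 2` has abelian, hence soluble, automorphism group**
(`|Aut(E/F)| ≤ [E : F] ≤ 2`). [folklore] -/
theorem isSolvable_algEquiv_of_finrank_le_two {E : Type*} [Field E] [Algebra F E]
    [FiniteDimensional F E] (h : Module.finrank F E ≤ 2) : IsSolvable (E ≃ₐ[F] E) := by
  classical
  have hcard : Nat.card (E ≃ₐ[F] E) ≤ 2 := by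
    rw [Nat.card_eq_fintype_card]
    exact AlgEquiv.card_le.trans h
  exact isSolvable_of_comm (mul_comm_of_card_le_two hcard)

/-- **A separable extension of degree `2` is Galois** (Mathlib `IsQuadraticExtension.isGalois`,
restated from the numerical hypothesis `[E : F] = 2`). [folklore] -/
theorem isGalois_of_finrank_eq_two {E : Type*} [Field E] [Algebra F E] [Algebra.IsSeparable F E]
    (h : Module.finrank F E = 2) : IsGalois F E :=
  haveI : Algebra.IsQuadraticExtension F E := { finrank_eq_two' := h }
  inferInstance

/-- **A separable subextension of degree `≤ 2` is finite Galois with soluble group** (degree `1`: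
`E = F`; degree `2`: quadratic). [folklore] -/
theorem isGalois_and_isSolvable_of_finrank_le_two (E : IntermediateField F L)
    [Algebra.IsSeparable F E] [FiniteDimensional F E] (h : Module.finrank F E ≤ 2) :
    IsGalois F E ∧ IsSolvable (E ≃ₐ[F] E) := by
  refine ⟨?_, isSolvable_algEquiv_of_finrank_le_two h⟩
  rcases Nat.lt_or_ge (Module.finrank F E) 2 with hlt | hge
  · have h1 : Module.finrank F E = 1 :=
      le_antisymm (by omega) (Nat.succ_le_of_lt Module.finrank_pos)
    rw [IntermediateField.finrank_eq_one_iff] at h1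
    subst h1
    infer_instance
  · exact isGalois_of_finrank_eq_two (le_antisymm h hge)

/-- **`E₀ · Q` is Galois and soluble** for `E₀` finite Galois with soluble group and `Q` a
separable subextension of degree `≤ 2` — the inductive step for `E = E₀ · E_a · E_b · E_c` in
ACC+ 2023 ("Then `E/F` is a soluble … extension").
[cite: ACCGHLNSTT2023, §6.5, proof of Thm. 6.1.1 (p. 89 of arXiv:1812.09999)] -/
theorem isGalois_and_isSolvable_sup_of_finrank_le_two (E₀ Q : IntermediateField F L)
    [FiniteDimensional F E₀] [IsGalois F E₀] [IsSolvable (E₀ ≃ₐ[F] E₀)]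
    [Algebra.IsSeparable F Q] [FiniteDimensional F Q] (hQ : Module.finrank F Q ≤ 2) :
    FiniteDimensional F (E₀ ⊔ Q : IntermediateField F L) ∧
      IsGalois F (E₀ ⊔ Q : IntermediateField F L) ∧
      IsSolvable ((E₀ ⊔ Q : IntermediateField F L) ≃ₐ[F] (E₀ ⊔ Q : IntermediateField F L)) := by
  obtain ⟨hG, hS⟩ := isGalois_and_isSolvable_of_finrank_le_two Q hQ
  haveI := hG
  haveI := hS
  exact isGalois_and_isSolvable_sup E₀ Q

end Literature.FieldTheory.Galois

end
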